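import Literature.AnabelianGeometry.SemiGraphs.ArithTreeTower
import Literature.AnabelianGeometry.SemiGraphs.TemperedPiLevelCosetIso
import HarnessLib

/-!
# The arithmetic actions on the finite levels `𝔾_{S n}` of the Galois tower ([SemiAnbd] Def 5.1 (i), Thm 5.4 p. 66)

Mochizuki, *Semi-graphs of anabelioids*, Publ. RIMS **42** (2006), §5: Definition 5.1 (i) p. 62 and the
proof of Theorem 5.4 p. 66 ("since the action of `H` on `π₁^temp(𝒢)` is quasi-geometric, it follows that
we obtain natural compatible actions of `H` on `𝔾`, `𝔾_i`, `𝔾'_i`") [cite: MochizukiSemiAnbd2006, Thm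
5.4, p. 66].

Cell row T54-B (plan/GAP-LEDGER.md G-w4d053-1), tower third, file T3e-3: for a group `E` acting on
`π₁^temp(𝒢)` (`Φ`) and on `𝔾` (`σ`), compatibly with the presentation of `𝔾` inside `π₁^temp(𝒢)`
(`hP`) and stabilising the finite-level kernels `ker π_n` (`hN`), the ARITHMETIC ACTIONS
`D.arithLevelAct n : E →* Aut (D.S n).orbitGraph` on abc-iut-L3-t6's finite levels: the canonical action
on coset semi-graphs (`SubgroupPresentation.arithAct`) at the level `ker π_n`, transported along
`D.levelCosetIso hconn T R n` (`TemperedPiLevelCosetIso.lean`).  PROVED: the arithmetic tree actions of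
`ArithTreeTower.lean` COVER them through t6's `treeQuot n` (`arithTreeAct_treeQuot`, the `act_quot` field
of the cell's `ArithLevelData`), they EXTEND t6's `levelAct` along the inner action
(`arithLevelAct_inner`), they lie over `σ` (`arithLevelAct_comp_orbitGraphProj`) and COMMUTE WITH THE
FINITE-LEVEL TRANSITIONS (`arithLevelAct_levelStep`, the `levelTrans_act` field for consecutive levels).
Typed ≠ proved for [SemiAnbd] Thm 5.4 itself; nothing here bears on [IUTchIII] Cor. 3.12.
-/

namespace Literature.AnabelianGeometry.SemiGraphs

namespace ProfiniteSemiGraph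

namespace GaloisLevelData

open CategoryTheory

universe u v

variable {𝒢 : ProfiniteSemiGraph.{u}} (D : GaloisLevelData 𝒢) (h𝒢 : 𝒢.IsCountable)
  (hconn : ∀ (n : ℕ) (p q : (D.S n).Point), (D.S n).SameComponent p q)
  (T : ∀ w : 𝒢.graph.Vertex, D.PointSeq h𝒢 w) (R : SemiGraph.RefBranches 𝒢.graph)
  {E : Type v} [Group E] {Φ : E →* MulAut (D.temperedPi h𝒢)} {σ : E →* Aut 𝒢.graph}
  (hP : (D.piPresentation h𝒢 T R).IsArithCompatible Φ σ)
  (hK : ∀ (n : ℕ) (e : E) (x : D.temperedPi h𝒢), x ∈ (D.projAut h𝒢 n).ker → Φ e x ∈ (D.projAut h𝒢 n).ker)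
  (hN : ∀ (n : ℕ) (e : E) (x : D.temperedPi h𝒢),
    x ∈ (D.piLevelAut h𝒢 hconn n).ker → Φ e x ∈ (D.piLevelAut h𝒢 hconn n).ker)

/-- **The arithmetic action of `E` on the finite level `𝔾_{S n}`**: the canonical action on the coset
semi-graph of `π₁^temp(𝒢)` at the level `ker π_n`, transported along `levelCosetIso`.
[cite: MochizukiSemiAnbd2006, Thm 5.4, p. 66] -/
noncomputable def arithLevelAct (n : ℕ) : E →* Aut (D.S n).orbitGraph :=
  AutTransport.transportAct ((D.piPresentation h𝒢 T R).arithAct hP (D.piLevelAut h𝒢 hconn n).ker (hN n))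
    (D.levelCosetIso h𝒢 hconn T R n)

/-- The arithmetic level action, on `hom`s. [cite: MochizukiSemiAnbd2006, Thm 5.4, p. 66] -/
theorem arithLevelAct_hom (n : ℕ) (e : E) :
    (D.arithLevelAct h𝒢 hconn T R hP hN n e).hom = (D.levelCosetIso h𝒢 hconn T R n).inv ≫
      ((D.piPresentation h𝒢 T R).arithAct hP (D.piLevelAut h𝒢 hconn n).ker (hN n) e).hom ≫
        (D.levelCosetIso h𝒢 hconn T R n).hom :=
  AutTransport.transportAct_hom _ _ e

/-- **The arithmetic level action covers `σ` on `𝔾`.** [cite: MochizukiSemiAnbd2006, Thm 5.4, p. 66] -/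
theorem arithLevelAct_comp_orbitGraphProj (n : ℕ) (e : E) :
    (D.arithLevelAct h𝒢 hconn T R hP hN n e).hom ≫ (D.S n).orbitGraphProj =
      (D.S n).orbitGraphProj ≫ (σ e).hom :=
  AutTransport.transportAct_comp_proj _ _ ((D.piPresentation h𝒢 T R).cosetGraphProj _) (D.S n).orbitGraphProj
    (D.levelCosetIso_hom_comp_orbitGraphProj h𝒢 hconn T R n) σ
    (fun e => (D.piPresentation h𝒢 T R).arithAct_comp_proj hP _ _ e) e

/-- **`act_quot`: the arithmetic tree action covers the arithmetic level action through abc-iut-L3-t6's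
universal graph-covering `treeQuot n : 𝒢_{∞,n} → 𝔾_{S n}`.** [cite: MochizukiSemiAnbd2006, Thm 5.4, p. 66] -/
theorem arithTreeAct_treeQuot (n : ℕ) (e : E) :
    (D.arithTreeAct h𝒢 T R hP hK n e).hom ≫ D.treeQuot n =
      D.treeQuot n ≫ (D.arithLevelAct h𝒢 hconn T R hP hN n e).hom :=
  AutTransport.transportAct_comp_trans _ _ _ _ ((D.piPresentation h𝒢 T R).cosetGraphTrans
      (D.ker_projAut_le_ker_piLevelAut h𝒢 hconn n)) (D.treeQuot n) (D.treeCosetIso_quot h𝒢 hconn T R n)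
    (fun e => (D.piPresentation h𝒢 T R).arithAct_trans hP (hK n) (hN n)
      (D.ker_projAut_le_ker_piLevelAut h𝒢 hconn n) e) e

/-- **The arithmetic level action EXTENDS abc-iut-L3-t6's `levelAct` along the inner action**: for
`ι : π₁^temp(𝒢) → E` with `Φ (ι g) = conj g` and `σ (ι g) = 1`, `arithLevelAct n (ι g) = D.levelAct n g`.
[cite: MochizukiSemiAnbd2006, Thm 5.4, p. 66] -/
theorem arithLevelAct_inner (n : ℕ) (ι : D.temperedPi h𝒢 →* E)
    (hιΦ : ∀ g, Φ (ι g) = MulAut.conj g) (hισ : ∀ g, σ (ι g) = 1) (g : D.temperedPi h𝒢) :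
    D.arithLevelAct h𝒢 hconn T R hP hN n (ι g) = D.levelAct h𝒢 hconn n g :=
  AutTransport.transportAct_eq_of_comp_eq _ _
    ((D.piPresentation h𝒢 T R).arithAct_eq_deckAct_of_inner hP _ _ (hιΦ g) (hισ g))
    (D.deckAct_comp_levelCosetIso h𝒢 hconn T R n g)

/-- **`levelTrans_act` (consecutive levels): the arithmetic level actions commute with the transitions
`𝔾(S (n+1) → S n)`.** [cite: MochizukiSemiAnbd2006, Thm 5.4, p. 66] -/
theorem arithLevelAct_levelStep (n : ℕ) (e : E) :
    (D.arithLevelAct h𝒢 hconn T R hP hN (n + 1) e).hom ≫ CovObj.orbitGraphMap (D.g n) =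
      CovObj.orbitGraphMap (D.g n) ≫ (D.arithLevelAct h𝒢 hconn T R hP hN n e).hom :=
  AutTransport.transportAct_comp_trans _ _ _ _ ((D.piPresentation h𝒢 T R).cosetGraphTrans
      (D.ker_piLevelAut_succ_le h𝒢 hconn n)) (CovObj.orbitGraphMap (D.g n))
    (D.levelCosetIso_trans h𝒢 hconn T R n)
    (fun e => (D.piPresentation h𝒢 T R).arithAct_trans hP (hN (n + 1)) (hN n)
      (D.ker_piLevelAut_succ_le h𝒢 hconn n) e) e

/-- The kernel of the arithmetic level action is the kernel of the coset action at `ker π_n`.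
[cite: MochizukiSemiAnbd2006, Prop 5.2 (iv), p. 64] -/
theorem ker_arithLevelAct (n : ℕ) :
    (D.arithLevelAct h𝒢 hconn T R hP hN n).ker =
      ((D.piPresentation h𝒢 T R).arithAct hP (D.piLevelAut h𝒢 hconn n).ker (hN n)).ker :=
  AutTransport.ker_transportAct _ _

/-- The level kernel at `ker π_n` acts trivially on `𝔾_{S n}`. [cite: MochizukiSemiAnbd2006, Prop 5.2 (iv), p. 64] -/
theorem arithLevelAct_eq_one_of_mem_levelKer (n : ℕ) {e : E}
    (he : e ∈ (D.piPresentation h𝒢 T R).levelKer hP (D.piLevelAut h𝒢 hconn n).ker (hN n)) :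
    D.arithLevelAct h𝒢 hconn T R hP hN n e = 1 := by
  rw [SemiGraph.SubgroupPresentation.mem_levelKer_iff] at he
  rw [← MonoidHom.mem_ker, D.ker_arithLevelAct h𝒢 hconn T R hP hN n, MonoidHom.mem_ker]
  exact he.1

end GaloisLevelData

end ProfiniteSemiGraph

end Literature.AnabelianGeometry.SemiGraphs
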